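import Mathlib.Analysis.Calculus.ParametricIntegral
import Mathlib.Analysis.SpecialFunctions.Log.Deriv
import Mathlib.Analysis.SpecialFunctions.ExpDeriv
import Mathlib.MeasureTheory.Integral.Bochner.Basic
import HarnessLib

/-!
# NE7, ROAD P4 (law-level): NODE Q.old, item (k13) — THE GENERATING-FUNCTION IDENTITY
# (`DERIVATION-QLa-NE7-P4.md` §3 (a): the fibre mean of an observable is the derivative at zero of the logarithm of
# the source-modified partition function)

(Cell `pub-balaban`, sub-cell `t4`, binder row NE7 = node U5, co-owner #4 `b2b-balaban-t4-ne7-p4`, gen 4; skeleton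
`HOME/t4/skeletons/NE7-t4-ne7-p4.md` v1.10 §2 NODE Q.old leaf (QL-a); derivation file
`HOME/t4/b2b-balaban-t4-ne7-p4/g4/DERIVATION-QLa-NE7-P4.md` §0 (0d), §3 (a).)

HONEST FRAMING (T4-DAG PAGE 1).  Rung (B)+1 on ONE FIXED finite four-torus, CONDITIONAL on `BetaPertH` and the nine
spine estimates (0/9 proved); NOT infinite volume, NOT a mass gap, NOT the Clay problem.  NE7 is NOT PRINTED and NOT
proved here.  Pure [folklore] calculus ∕ measure theory (differentiation under the integral sign), sorry-free; nothing
of the audited series is asserted; NOT summit progress.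

WHAT IS PROVED.  For a finite measure `μ` and a bounded measurable `f`:
* `hasDerivAt_integral_exp_mul` — `ζ ↦ ∫ exp(ζ·f) dμ` has derivative `∫ f dμ` at `ζ = 0`;
* `hasDerivAt_log_integral_exp_mul` — for a probability measure, `ζ ↦ log ∫ exp(ζ·f) dμ` has derivative `∫ f dμ`
  at `0` (DICTIONARY: `μ` = the normalised T-fibre law `m_k(W)` of the small-field term, `f` = the inserted observable
  `O(U_k(·))`; the source-modified action `A_k + ζO` has fibre partition function `ζ ↦ ∫ exp(ζO)`, and the identity is
  `E_{m_k(W)}[O] = ∂_ζ|₀ log ∫ e^{ζO} dm_k(W)` — `DERIVATION-QLa` §3 (a));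
* `hasDerivAt_log_integral_exp_mul_of_ne_zero` — the same for a non-zero finite measure, with derivative
  `(∫ f dμ)/μ(univ)` (the unnormalised fibre integral: W-independent normalisations drop out of the log-derivative).
-/

noncomputable section

open MeasureTheory Metric Set Filter

namespace Summit.QuantumFields.BalabanUV.T4Continuum.NE7LawLevel

variable {Ω : Type*} {mΩ : MeasurableSpace Ω} {μ : Measure Ω}

/-- **DIFFERENTIATION UNDER THE INTEGRAL for the exponential generating function.**  For a finite measure `μ` and a
measurable `f` with `|f| ≤ B`: `ζ ↦ ∫ exp(ζ·f ω) dμ` has derivative `∫ f dμ` at `ζ = 0`. [folklore] -/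
theorem hasDerivAt_integral_exp_mul [IsFiniteMeasure μ] {f : Ω → ℝ} (hfm : Measurable f) {B : ℝ}
    (hfb : ∀ ω, |f ω| ≤ B) :
    HasDerivAt (fun ζ : ℝ => ∫ ω, Real.exp (ζ * f ω) ∂μ) (∫ ω, f ω ∂μ) 0 := by
  -- the derivative field and the dominating bound on the unit ball around 0
  set F : ℝ → Ω → ℝ := fun ζ ω => Real.exp (ζ * f ω) with hF
  set F' : ℝ → Ω → ℝ := fun ζ ω => Real.exp (ζ * f ω) * f ω with hF'
  have hs : ball (0 : ℝ) 1 ∈ nhds (0 : ℝ) := ball_mem_nhds 0 one_pos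
  have hF_meas : ∀ᶠ ζ in nhds (0 : ℝ), AEStronglyMeasurable (F ζ) μ :=
    Eventually.of_forall fun ζ =>
      (Real.continuous_exp.measurable.comp (hfm.const_mul ζ)).aestronglyMeasurable
  have hF_int : Integrable (F 0) μ := by
    have : F 0 = fun _ => (1 : ℝ) := by funext ω; simp [hF]
    rw [this]; exact integrable_const 1
  have hF'_meas : AEStronglyMeasurable (F' 0) μ :=
    ((Real.continuous_exp.measurable.comp (hfm.const_mul 0)).mul hfm).aestronglyMeasurable
  have h_bound : ∀ᵐ ω ∂μ, ∀ ζ ∈ ball (0 : ℝ) 1, ‖F' ζ ω‖ ≤ B * Real.exp B := by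
    refine ae_of_all μ fun ω ζ hζ => ?_
    have hζ1 : |ζ| ≤ 1 := by
      have := mem_ball_zero_iff.mp hζ
      exact le_of_lt (by simpa using this)
    have hprod : ζ * f ω ≤ B := by
      calc ζ * f ω ≤ |ζ * f ω| := le_abs_self _
        _ = |ζ| * |f ω| := abs_mul _ _
        _ ≤ 1 * B := mul_le_mul hζ1 (hfb ω) (abs_nonneg _) zero_le_one
        _ = B := one_mul B
    have hB : 0 ≤ B := (abs_nonneg _).trans (hfb ω)
    rw [hF', Real.norm_eq_abs, abs_mul, Real.abs_exp]
    calc Real.exp (ζ * f ω) * |f ω| ≤ Real.exp B * B :=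
          mul_le_mul (Real.exp_le_exp.mpr hprod) (hfb ω) (abs_nonneg _) (Real.exp_pos _).le
      _ = B * Real.exp B := mul_comm _ _
  have bound_integrable : Integrable (fun _ : Ω => B * Real.exp B) μ := integrable_const _
  have h_diff : ∀ᵐ ω ∂μ, ∀ ζ ∈ ball (0 : ℝ) 1, HasDerivAt (fun ζ => F ζ ω) (F' ζ ω) ζ := by
    refine ae_of_all μ fun ω ζ _ => ?_
    have h1 : HasDerivAt (fun ζ : ℝ => ζ * f ω) (f ω) ζ := by
      simpa using (hasDerivAt_id ζ).mul_const (f ω)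
    simpa [hF, hF'] using h1.exp
  have key := (hasDerivAt_integral_of_dominated_loc_of_deriv_le hs hF_meas hF_int hF'_meas h_bound
    bound_integrable h_diff).2
  have hF'0 : (∫ ω, F' 0 ω ∂μ) = ∫ ω, f ω ∂μ := by
    refine integral_congr_ae (ae_of_all μ fun ω => ?_)
    simp [hF']
  rw [hF'0] at key
  exact key

/-- **THE GENERATING-FUNCTION IDENTITY (probability measure).**  For a probability measure `μ` and a measurable `f`
with `|f| ≤ B`: `ζ ↦ log ∫ exp(ζ·f) dμ` has derivative `∫ f dμ` at `ζ = 0` — «the mean is the derivative at zero of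
the logarithm of the source-modified partition function». [folklore] -/
theorem hasDerivAt_log_integral_exp_mul [IsProbabilityMeasure μ] {f : Ω → ℝ} (hfm : Measurable f) {B : ℝ}
    (hfb : ∀ ω, |f ω| ≤ B) :
    HasDerivAt (fun ζ : ℝ => Real.log (∫ ω, Real.exp (ζ * f ω) ∂μ)) (∫ ω, f ω ∂μ) 0 := by
  have hZ := hasDerivAt_integral_exp_mul (μ := μ) hfm hfb
  have hZ0 : (∫ ω, Real.exp (0 * f ω) ∂μ) = 1 := by simp
  have hlog : HasDerivAt Real.log (∫ ω, Real.exp (0 * f ω) ∂μ)⁻¹ (∫ ω, Real.exp (0 * f ω) ∂μ) :=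
    Real.hasDerivAt_log (by rw [hZ0]; exact one_ne_zero)
  have hcomp := hlog.comp (0 : ℝ) hZ
  rw [hZ0, inv_one, one_mul] at hcomp
  exact hcomp

/-- **THE GENERATING-FUNCTION IDENTITY (non-zero finite measure).**  For a finite measure `μ ≠ 0` and a measurable
`f` with `|f| ≤ B`: `ζ ↦ log ∫ exp(ζ·f) dμ` has derivative `(∫ f dμ)/(μ univ)` at `ζ = 0` (the unnormalised fibre
integral; constant normalisations drop out of the log-derivative). [folklore] -/
theorem hasDerivAt_log_integral_exp_mul_of_ne_zero [IsFiniteMeasure μ] (hμ : μ ≠ 0) {f : Ω → ℝ}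
    (hfm : Measurable f) {B : ℝ} (hfb : ∀ ω, |f ω| ≤ B) :
    HasDerivAt (fun ζ : ℝ => Real.log (∫ ω, Real.exp (ζ * f ω) ∂μ)) ((∫ ω, f ω ∂μ) / μ.real univ) 0 := by
  have hZ := hasDerivAt_integral_exp_mul (μ := μ) hfm hfb
  have hZ0 : (∫ ω, Real.exp (0 * f ω) ∂μ) = μ.real univ := by simp
  have hpos : 0 < μ.real univ := by
    rw [measureReal_def, ENNReal.toReal_pos_iff]
    exact ⟨pos_iff_ne_zero.mpr (Measure.measure_univ_ne_zero.mpr hμ), measure_lt_top μ univ⟩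
  have hlog : HasDerivAt Real.log (∫ ω, Real.exp (0 * f ω) ∂μ)⁻¹ (∫ ω, Real.exp (0 * f ω) ∂μ) :=
    Real.hasDerivAt_log (by rw [hZ0]; exact hpos.ne')
  have hcomp := hlog.comp (0 : ℝ) hZ
  rw [hZ0, ← div_eq_inv_mul] at hcomp
  exact hcomp

end Summit.QuantumFields.BalabanUV.T4Continuum.NE7LawLevel

end
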